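import Summits.HodgeConjecture.HodgeConjecture.Theorems.VHCAbelianSchemesRoadSecantQuotientAnchorSameAnchorTransferDefs
import Summits.HodgeConjecture.HodgeConjecture.Theorems.VHCAbelianSchemesRoadSecantQuotientAnchorPinnedWeilPlane
import Literature.AlgebraicGeometry.HodgeTheory.HodgeClassesIsogenyInvariance
import HarnessLib

/-!
# Road b02 (`VHCAbelianSchemesRoad`, D-0059) — lane W1 of crux `SemiregularSheafRepresentativesTwPrimeAtDiag` (item stmt-HodgeConjecture-20707,
# skeleton v3.3), stub 2a‴ ∕ node (G3) `SecantQuotientSameAnchorTransfer63`: the ONE cheap mechanism that moves a carried direction at a FIXED anchor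
# — pull-back along an ENDOMORPHISM scaling the polarisation, under DISPLAYED pull-back stability of the door — and what it buys for (G3) (fact-free)

research route conditional on HC_CM; not a corollary; Q11.4-sentence-2 already refuted in dim ≥ 3.

THEOREMS ONLY (no definition, no named fact, `HC_CM` nowhere; nothing of an existing file edited). ring2-b03x gen 4 on director-hodge g10 (HOME INBOX
2026-08-27T19:55:49Z «the mathematics of G3′ … typed sufficiency lemma of whatever is proved»). The companion memo (evidence on 20707,
`evidence-20707-b03x-g4.md`) decides the σ̄-probe of record on paper: at print's anchor `(Y_d, h_Y)`, `Y_d = (J × Ĵ)/Ḡ`, `Ḡ = {(x₁ − x₂, φ_Θ(x₁ + x₂))}`,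
`End J = ℤ`, (i) NO automorphism of `(Y_d, h_Y)` swaps the Weil eigen-lines (`Aut(Y_d) = Aut(J × Ĵ)_Ḡ`, and `Stab(Ξ_d) ∩ Aut(J × Ĵ)_Ḡ = {±1}`
acts trivially on `H^{ev}`); (ii) every `E₊∕E₋`-swapping ISOGENY of `Y_d`, and `ψ_Y = r ≫ φ_d ≫ q`, factors through `q` and therefore pulls the
semiregular twisted sheaf `𝓑` back to a NON-semiregular one (`Ext²_Y(𝓑, 𝓑 ⊗ L) ≠ 0` for some `L ∈ ker q^* ∖ 0`, because
`dim Ext²_{J×Ĵ}(𝓔, 𝓔) = (3d+6)(3d+8) > 66 = dim HT²`); (iii) the direct descents `ḡ_u` of `u ∈ ℤ[φ_d]` (`φ_d(Ḡ) = Ḡ`) move print's direction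
`[1]` to `[u⁶]`, their pull-backs are admissible iff `Ext²(𝓑, 𝓑 ⊗ L) = 0` on `ker ḡ_u^* ∖ 0` (OPEN; `gcd(Nm u, d+1) = 1` needed against the known
obstruction), and the reached set `{[u⁶]} ⊊ P(W_ℚ) = K^×/ℚ^×` has INFINITE index. THIS file types the positive half of (iii), door-generically:

* §1 `carriedClasses 𝒪 n p X θ` is homogeneous (`smul_mem_carriedClasses`) and moves along an endomorphism `g : X ⟶ X` with `g^*θ = N·θ` whenever
  the door is stable under `g^*` on `X` (`map_mem_carriedClasses_of_pullbackStable`; the rays `ℂ·θ^q` are `g^*`-stable: `g^*θ^q = N^q·θ^q`);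
  orbit closure of an anchored-carrier statement under such endomorphism orbits (`anchoredCarrierAt_of_endOrbit`, the isogeny analogue of
  `anchoredCarrierAt_of_autOrbit`, p535565).
* §2 (G3)-shaped instances: `SecantQuotientSameAnchorTransfer63 𝒪` holds for every pair `(w, w')` with `w = t·g^*w'` on such an orbit
  (`mem_carriedClasses_of_endOrbit`), hence (G3) ∕ (G3′) follow from the DISPLAYED orbit-exhaustion hypothesis
  (`secantQuotientSameAnchorTransfer63_of_endOrbitExhaustion`, primed twin) — which is FALSE as arithmetic beyond the sixth-power coset (memo §3):
  this is the exact extent of the mechanism, not a route to (G3).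
* §3 the orbit is INSIDE (G3)'s domain: at the identity chart of a datum, pulling a pinned-served class back along an isogeny `g` of `Y` intertwined
  through `q` with an endomorphism `u` of `J × Ĵ` commuting with `φ_d` gives a pinned-served class (`SecantQuotientDatum.map_mem_servedClassesPinned_of_intertwiner`)
  — so (G3) OWES the directions `[u⁶]·[γ₀]`, and §2 pays them exactly when the door is `ḡ_u`-pull-back stable.

HONEST LIMITS. Pull-back stability of the twisted door `twistedReflexiveClass C AdmTw′` along a finite étale `g` is NOT a theorem and not claimed: it needs
the Chern data `C` to commute with `g^*` and `AdmTw′` to survive `g^*`, i.e. `Ext²(E, E ⊗ L) = 0` for every `L ∈ ker g^* ∖ 0` (memo §2, exact criterion);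
for `g` through `q` it FAILS at print's object. Nothing here says (G3), (G1), the node, L1″, 2a‴, any cell ∕ rung ∕ crux, K-SR♭∃, VHC, `HC_AV`, `HC_CM` or HC holds.
References: [cite: Markman2025SecantWeil, §1.3 Cor. 1.3.2, Thm. 1.4.1 (item 4), §1.5 (p. 7), Lemma 6.2.1, Conj. 6.2.8, Lemma 8.3.1, Lemma 8.3.2, §9.3 Lemma 9.3.2–9.3.5]
[cite: Bloch1972Semiregularity, Remark (7.5)] [cite: BuchweitzFlenner2003, §5 Thm. 5.1] [cite: vanGeemen1994HodgeAV, §3.6, 4.9 and Lemma 5.2] [cite: MumfordAV1970, §7 Thm. 4 p. 72].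
-/

noncomputable section

open CategoryTheory CategoryTheory.Limits AlgebraicGeometry Topology

namespace Summit.HodgeConjecture.HodgeConjecture.Ring2.SemiregularRepresentatives

set_option linter.dupNamespace false -- the cell's namespace repeats the summit name, as in every `Ring2*` file

open Literature.AlgebraicGeometry Literature.AlgebraicGeometry.Motives Literature.AlgebraicGeometry.Motives.AbelianVariety
open Literature.AlgebraicGeometry.HodgeTheory Literature.AlgebraicGeometry.Markman2025
open Literature.AlgebraicTopology.SingularHomology
open Summit.Ventures.HSemireg (ObjClass)
open Summit.HodgeConjecture.HodgeConjecture.Ring2.AbelianAll (carriedClasses)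

/-! ## §1 Door-generic: carried classes are homogeneous and move along polarisation-scaling endomorphisms under pull-back stability -/

section Generic

variable {𝒪 : ObjClass} {n p : ℕ} {X : SchemeOver ℂ} {θ : complexBetti X 2}

/-- **`g^*θ = N·θ ⟹ g^*(θ^q) = N^q·θ^q`** for an endomorphism `g : X ⟶ X` of a complex scheme (pull-back is a ring map: `map_cupPowTwo`;
`(N·θ)^q = N^q·θ^q`: `cupPowTwo_smul`) — the rays `ℂ·θ^q` of an anchor are stable under every endomorphism scaling `θ` (an isogeny `ḡ_u` of a
compatibly polarised Weil-type anchor scales `h` by `Nm(u)`). [cite: HatcherAT2002, §3.2] [cite: vanGeemen1994HodgeAV, 4.9 (E(kx, ky) = Nm(k)E(x, y))] -/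
theorem complexBetti_map_cupPowTwo_of_map_eq_smul (g : X ⟶ X) {N : ℂ} (hgθ : complexBetti.map g 2 θ = N • θ) (q : ℕ) :
    complexBetti.map g (2 * q) (cupPowTwo θ q) = N ^ q • cupPowTwo θ q := by
  change singularCohomology.map ℂ ℂ _ (2 * q) (cupPowTwo θ q) = _
  rw [map_cupPowTwo]
  change cupPowTwo (complexBetti.map g 2 θ) q = _
  rw [hgθ, cupPowTwo_smul]

/-- **`carriedClasses 𝒪 n p X θ` is homogeneous**: a non-zero multiple of a carried class is carried (same datum, `a ↦ a·t⁻¹`). Directions, not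
classes, are what a door datum serves. [cite: Bloch1972Semiregularity, Remark (7.5)] -/
theorem smul_mem_carriedClasses {w : complexBetti X (2 * p)} {t : ℂ} (ht : t ≠ 0) (hw : w ∈ carriedClasses 𝒪 n p X θ) :
    t • w ∈ carriedClasses 𝒪 n p X θ := by
  obtain ⟨I, κ, a, c, hpI, hκ, ha, hκp, hκq⟩ := hw
  refine ⟨I, κ, a * t⁻¹, c, hpI, hκ, mul_ne_zero ha (inv_ne_zero ht), ?_, hκq⟩
  rw [hκp, smul_smul, mul_assoc, inv_mul_cancel₀ ht, mul_one]

/-- **PULL-BACK TRANSFER ALONG A POLARISATION-SCALING ENDOMORPHISM, UNDER DISPLAYED PULL-BACK STABILITY OF THE DOOR**: if `g : X ⟶ X` has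
`g^*θ = N·θ` and the door `𝒪` is stable under `κ ↦ g^*κ` ON `X`, then `g^*` maps carried classes to carried classes (transport the datum:
`g^*κ_p = a·g^*w + c_p N^p·θ^p`, `g^*κ_q = c_q N^q·θ^q`). For the twisted door along a finite étale `g` the stability hypothesis is the exact
open condition «`Ext²(E, E ⊗ L) = 0` for `L ∈ ker g^* ∖ 0`» (module docstring) — NOT claimed. [cite: Bloch1972Semiregularity, Remark (7.5)]
[cite: BuchweitzFlenner2003, §5 Thm. 5.1] [cite: Markman2025SecantWeil, Thm. 1.4.1 (item 4) and §9.3 Lemma 9.3.2] -/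
theorem map_mem_carriedClasses_of_pullbackStable (g : X ⟶ X) {N : ℂ} (hgθ : complexBetti.map g 2 θ = N • θ)
    (h𝒪 : ∀ (I : Finset ℕ) (κ : (q : ℕ) → complexBetti X (2 * q)), 𝒪 n X I κ → 𝒪 n X I (fun q ↦ complexBetti.map g (2 * q) (κ q)))
    {w : complexBetti X (2 * p)} (hw : w ∈ carriedClasses 𝒪 n p X θ) :
    complexBetti.map g (2 * p) w ∈ carriedClasses 𝒪 n p X θ := by
  obtain ⟨I, κ, a, c, hpI, hκ, ha, hκp, hκq⟩ := hw
  refine ⟨I, fun q ↦ complexBetti.map g (2 * q) (κ q), a, fun q ↦ c q * N ^ q, hpI, h𝒪 I κ hκ, ha, ?_, fun q hq hqp ↦ ?_⟩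
  · change complexBetti.map g (2 * p) (κ p) = _
    rw [hκp, map_add, map_smul, map_smul, complexBetti_map_cupPowTwo_of_map_eq_smul g hgθ p, smul_smul]
  · change complexBetti.map g (2 * q) (κ q) = _
    rw [hκq q hq hqp, map_smul, complexBetti_map_cupPowTwo_of_map_eq_smul g hgθ q, smul_smul]

/-- **The orbit form**: every class `t·g^*w'`, `t ≠ 0`, on the `g`-orbit of a carried class `w'` is carried, for `g` scaling `θ` and `𝒪` `g^*`-stable
on `X`. [cite: Bloch1972Semiregularity, Remark (7.5)] [cite: Markman2025SecantWeil, Thm. 1.4.1 (item 4)] -/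
theorem mem_carriedClasses_of_endOrbit (g : X ⟶ X) {N : ℂ} (hgθ : complexBetti.map g 2 θ = N • θ)
    (h𝒪 : ∀ (I : Finset ℕ) (κ : (q : ℕ) → complexBetti X (2 * q)), 𝒪 n X I κ → 𝒪 n X I (fun q ↦ complexBetti.map g (2 * q) (κ q)))
    {w w' : complexBetti X (2 * p)} {t : ℂ} (ht : t ≠ 0) (hww' : w = t • complexBetti.map g (2 * p) w')
    (hw' : w' ∈ carriedClasses 𝒪 n p X θ) : w ∈ carriedClasses 𝒪 n p X θ := by
  rw [hww']
  exact smul_mem_carriedClasses ht (map_mem_carriedClasses_of_pullbackStable g hgθ h𝒪 hw')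

variable {𝔄 : ∀ X : SchemeOver ℂ, complexBetti X 2 → Prop}
  {𝔖₀ 𝔖 : ∀ (X : SchemeOver ℂ), complexBetti X 2 → Set (complexBetti X (2 * p))}

/-- **ORBIT CLOSURE UNDER POLARISATION-SCALING ENDOMORPHISMS** (the isogeny analogue of `anchoredCarrierAt_of_autOrbit`): if every class of
`𝔖 X θ` at an anchor is `t·g^*w₀` for an endomorphism `g` scaling `θ` along which `𝒪` is pull-back stable on `X`, a scalar `t ≠ 0` and a rational
`w₀ ∈ 𝔖₀ X θ`, then carriers for `𝔖₀` give carriers for `𝔖`. The stability and orbit hypotheses are DISPLAYED, not claimed.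
[cite: Bloch1972Semiregularity, Remark (7.5)] [cite: Markman2025SecantWeil, Thm. 1.4.1 (item 4) and §1.5] [cite: Andre1996Motifs, §1.1 (p. 10)] -/
theorem anchoredCarrierAt_of_endOrbit
    (horb : ∀ (X : SchemeOver ℂ) (θ : complexBetti X 2), 𝔄 X θ → ∀ w ∈ 𝔖 X θ,
      ∃ (g : X ⟶ X) (N t : ℂ) (w₀ : complexBetti X (2 * p)), complexBetti.map g 2 θ = N • θ ∧
        (∀ (I : Finset ℕ) (κ : (q : ℕ) → complexBetti X (2 * q)), 𝒪 n X I κ → 𝒪 n X I (fun q ↦ complexBetti.map g (2 * q) (κ q))) ∧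
        w₀ ∈ 𝔖₀ X θ ∧ IsRationalClass w₀ ∧ t ≠ 0 ∧ w = t • complexBetti.map g (2 * p) w₀)
    (h : AnchoredCarrierAt 𝒪 n p 𝔄 𝔖₀) : AnchoredCarrierAt 𝒪 n p 𝔄 𝔖 := by
  intro X θ hXθ w hw _
  obtain ⟨g, N, t, w₀, hgθ, h𝒪, hw₀, hw₀Q, ht, hw⟩ := horb X θ hXθ w hw
  have hc : w₀ ∈ carriedClasses 𝒪 n p X θ := h X θ hXθ w₀ hw₀ hw₀Q
  exact mem_carriedClasses_of_endOrbit g hgθ h𝒪 ht hw hc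

end Generic

/-! ## §2 (G3)-shaped instances: same-anchor transfer holds ON THE ENDOMORPHISM ORBITS, and only the orbit-exhaustion hypothesis separates it from (G3) -/

section SameAnchor

variable {𝒪 : ObjClass} {C : ChernCharacterBetti}

/-- **(G3) from the DISPLAYED orbit-exhaustion hypothesis**: if at every level-`d` secant–quotient anchor with class `(X, θ)` any two rational
pinned-served classes `w, w'` are related by `w = t·g^*w'` for an endomorphism `g : X ⟶ X` scaling `θ` along which `𝒪` is pull-back stable on `X`
(`t ≠ 0`), then `SecantQuotientSameAnchorTransfer63 𝒪`. HONEST: the hypothesis is FALSE as arithmetic — the descended `K`-isogenies reach only the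
sixth-power coset `{[u⁶]}` of a direction in `P(W_ℚ) = K^×/ℚ^×`, of infinite index (companion memo §3); this theorem records the exact extent of the
isogeny mechanism, not a route to (G3). [cite: Markman2025SecantWeil, Thm. 1.4.1 (item 4) and §1.5 (p. 7)] [cite: vanGeemen1994HodgeAV, 4.9]
[cite: Bloch1972Semiregularity, Remark (7.5)] -/
theorem secantQuotientSameAnchorTransfer63_of_endOrbitExhaustion
    (horb : ∀ (d : ℕ) ⦃X : SchemeOver ℂ⦄ ⦃θ : complexBetti X 2⦄ ⦃w w' : complexBetti X (2 * 3)⦄,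
      IsSecantQuotientAnchorWith d X θ → w ∈ secantQuotientServedClassesPinned X θ → IsRationalClass w →
      w' ∈ secantQuotientServedClassesPinned X θ → IsRationalClass w' →
      ∃ (g : X ⟶ X) (N t : ℂ), complexBetti.map g 2 θ = N • θ ∧
        (∀ (I : Finset ℕ) (κ : (q : ℕ) → complexBetti X (2 * q)), 𝒪 6 X I κ → 𝒪 6 X I (fun q ↦ complexBetti.map g (2 * q) (κ q))) ∧
        t ≠ 0 ∧ w = t • complexBetti.map g (2 * 3) w') :
    SecantQuotientSameAnchorTransfer63 𝒪 := by
  intro d X θ w w' hX hw hwQ hw' hw'Q hc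
  obtain ⟨g, N, t, hgθ, h𝒪, ht, hww'⟩ := horb d hX hw hwQ hw' hw'Q
  exact mem_carriedClasses_of_endOrbit g hgθ h𝒪 ht hww' hc

/-- **Primed twin**: (G3′) `SecantQuotientSameAnchorTransfer63PinnedPrime C` from orbit exhaustion for the primed twisted door `tw C AdmTw′`
(its pull-back stability along each `g` DISPLAYED inside the hypothesis). [cite: Markman2025SecantWeil, Thm. 1.4.1 (item 4), §1.5 and §9.3 Lemma 9.3.2]
[cite: BuchweitzFlenner2003, §5 Thm. 5.1] -/
theorem secantQuotientSameAnchorTransfer63PinnedPrime_of_endOrbitExhaustion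
    (horb : ∀ (d : ℕ) ⦃X : SchemeOver ℂ⦄ ⦃θ : complexBetti X 2⦄ ⦃w w' : complexBetti X (2 * 3)⦄,
      IsSecantQuotientAnchorWith d X θ → w ∈ secantQuotientServedClassesPinned X θ → IsRationalClass w →
      w' ∈ secantQuotientServedClassesPinned X θ → IsRationalClass w' →
      ∃ (g : X ⟶ X) (N t : ℂ), complexBetti.map g 2 θ = N • θ ∧
        (∀ (I : Finset ℕ) (κ : (q : ℕ) → complexBetti X (2 * q)),
          twistedReflexiveClass C (fun n X₀ I E => Summit.Ventures.HSemireg.gluableSigmaAdmissible n X₀ I E ∨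
              Literature.AlgebraicGeometry.HodgeTheory.bfSingleAdmissible' n X₀ I E) 6 X I κ →
          twistedReflexiveClass C (fun n X₀ I E => Summit.Ventures.HSemireg.gluableSigmaAdmissible n X₀ I E ∨
              Literature.AlgebraicGeometry.HodgeTheory.bfSingleAdmissible' n X₀ I E) 6 X I
            (fun q ↦ complexBetti.map g (2 * q) (κ q))) ∧
        t ≠ 0 ∧ w = t • complexBetti.map g (2 * 3) w') :
    SecantQuotientSameAnchorTransfer63PinnedPrime C :=
  secantQuotientSameAnchorTransfer63_of_endOrbitExhaustion horb

/-- **What the mechanism pays at print's anchor, by name** (modulo L1″(C, Adm)): at print's own anchor of every even level `d ≥ 4` there is a carried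
rational pinned-served `γ`, and EVERY class `t·g^*γ` (`t ≠ 0`) along an endomorphism `g` scaling the polarisation, with the door `g^*`-stable
there, is carried too — the sixth-power coset of print's direction, conditionally on stability; nothing outside it.
[cite: Markman2025SecantWeil, Thm. 1.4.1 (item 4), §1.5 (p. 7) and Lemma 9.3.11] [cite: Bloch1972Semiregularity, Remark (7.5)] -/
theorem exists_printAnchor_forall_endOrbit_carried_of_pinned {Adm : PerfectAdmissibility}
    (hM : Markman2025_secantQuotient_twistedCarrier_onJacobian_pinned C Adm) {d : ℕ} (hd : Even d) (h4 : 4 ≤ d) :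
    ∃ (X : SchemeOver ℂ) (θ : complexBetti X 2) (γ : complexBetti X (2 * 3)),
      IsSecantQuotientAnchorWith d X θ ∧ γ ∈ secantQuotientServedClassesPinned X θ ∧ IsRationalClass γ ∧
      γ ∈ carriedClasses (twistedReflexiveClass C Adm) 6 3 X θ ∧
      ∀ (g : X ⟶ X) (N t : ℂ), complexBetti.map g 2 θ = N • θ →
        (∀ (I : Finset ℕ) (κ : (q : ℕ) → complexBetti X (2 * q)),
          twistedReflexiveClass C Adm 6 X I κ → twistedReflexiveClass C Adm 6 X I (fun q ↦ complexBetti.map g (2 * q) (κ q))) →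
        t ≠ 0 → t • complexBetti.map g (2 * 3) γ ∈ carriedClasses (twistedReflexiveClass C Adm) 6 3 X θ := by
  obtain ⟨X, θ, γ, hX, hγ, hγQ, -, hc⟩ := exists_carried_secantQuotientPinned_of_pinned hM hd h4
  exact ⟨X, θ, γ, hX, hγ, hγQ, hc, fun g N t hgθ h𝒪 ht ↦ mem_carriedClasses_of_endOrbit g hgθ h𝒪 ht rfl hc⟩

end SameAnchor

/-! ## §3 The orbit lies inside (G3)'s domain: pull-backs of pinned-served classes along `q`-intertwined `K`-isogenies are pinned-served -/

namespace SecantQuotientDatum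

variable (D : SecantQuotientDatum)

/-- **`q^*(g^*γ) = u^*(q^*γ)`** for an endomorphism `g` of `Y` intertwined through `q` with an endomorphism `u` of `J × Ĵ` (`q ≫ g = u ≫ q`: `g` is the
descent `ḡ_u` of `u`; e.g. `u ∈ ℤ[φ_d]`, which preserves `Ḡ` because `φ_d ≡ diag(1, -1)` on `Ḡ ≅ G₁ × G₂`). [cite: Markman2025SecantWeil, §1.5 (p. 7) and §9.3 (eq. elements of G)] -/
theorem complexBetti_map_q_map_of_intertwiner {g : D.Y ⟶ D.Y} {u : D.P ⟶ D.P} (hqg : D.q ≫ g = u ≫ D.q) (k : ℕ) (γ : complexBetti D.Y.X k) :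
    complexBetti.map D.q.hom.hom.hom k (complexBetti.map g.hom.hom.hom k γ) =
      complexBetti.map u.hom.hom.hom k (complexBetti.map D.q.hom.hom.hom k γ) := by
  have h1 : complexBetti.map D.q.hom.hom.hom k (complexBetti.map g.hom.hom.hom k γ) = complexBetti.map (D.q ≫ g).hom.hom.hom k γ := by
    change _ = complexBetti.map (D.q.hom.hom.hom ≫ g.hom.hom.hom) k γ
    rw [complexBetti.map_comp]; rfl
  have h2 : complexBetti.map u.hom.hom.hom k (complexBetti.map D.q.hom.hom.hom k γ) = complexBetti.map (u ≫ D.q).hom.hom.hom k γ := by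
    change _ = complexBetti.map (u.hom.hom.hom ≫ D.q.hom.hom.hom) k γ
    rw [complexBetti.map_comp]; rfl
  rw [h1, h2, hqg]

/-- **Pull-back along a `q`-intertwined `K`-isogeny keeps `q^*γ` in the Weil plane**: if `q ≫ g = u ≫ q` with `u` commuting with `φ_d`, then
`q^*γ ∈ weilClassesOf (J × Ĵ) φ_d 3 d ⟹ q^*(g^*γ) ∈ weilClassesOf (J × Ĵ) φ_d 3 d` (`K`-linearity: `map_mem_weilClassesOf`).
[cite: vanGeemen1994HodgeAV, 4.8–4.9] [cite: Markman2025SecantWeil, Thm. 1.4.1 (item 4)] -/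
theorem map_q_map_mem_weilClassesOf_of_intertwiner {g : D.Y ⟶ D.Y} {u : D.P ⟶ D.P} (hqg : D.q ≫ g = u ≫ D.q) (hu : D.ψ ≫ u = u ≫ D.ψ)
    {γ : complexBetti D.Y.X (2 * 3)} (hW : complexBetti.map D.q.hom.hom.hom (2 * 3) γ ∈ weilClassesOf D.P D.ψ 3 D.d) :
    complexBetti.map D.q.hom.hom.hom (2 * 3) (complexBetti.map g.hom.hom.hom (2 * 3) γ) ∈ weilClassesOf D.P D.ψ 3 D.d := by
  rw [D.complexBetti_map_q_map_of_intertwiner hqg]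
  exact map_mem_weilClassesOf D.P D.ψ hu hW

/-- **The datum's non-zero rational Weil classes are stable under `q`-intertwined `K`-ISOGENIES**: for an isogeny `g` of `Y` with `q ≫ g = u ≫ q`,
`u` commuting with `φ_d`, a class `γ ≠ 0`, rational, with `q^*γ` in the Weil plane of `(J × Ĵ, φ_d)` pulls back to one of the same kind (`g^*` is
injective on `H⁶`: `complexBetti_map_bijective_of_isIsogeny`; rationality is preserved; `q^*(g^*γ) = u^*(q^*γ)`).
[cite: Markman2025SecantWeil, Thm. 1.4.1 (item 4) and §1.5 (p. 7)] [cite: vanGeemen1994HodgeAV, §3.6 and 4.9] -/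
theorem map_mem_setOf_ne_zero_rational_weil_of_intertwiner {g : D.Y ⟶ D.Y} (hg : IsIsogeny g) {u : D.P ⟶ D.P} (hqg : D.q ≫ g = u ≫ D.q)
    (hu : D.ψ ≫ u = u ≫ D.ψ) {γ : complexBetti D.Y.X (2 * 3)}
    (hγ : γ ∈ {γ : complexBetti D.Y.X (2 * 3) | γ ≠ 0 ∧ IsRationalClass γ ∧
      complexBetti.map D.q.hom.hom.hom (2 * 3) γ ∈ weilClassesOf D.P D.ψ 3 D.d}) :
    complexBetti.map g.hom.hom.hom (2 * 3) γ ∈ {γ : complexBetti D.Y.X (2 * 3) | γ ≠ 0 ∧ IsRationalClass γ ∧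
      complexBetti.map D.q.hom.hom.hom (2 * 3) γ ∈ weilClassesOf D.P D.ψ 3 D.d} := by
  obtain ⟨hγ0, hγQ, hW⟩ := hγ
  refine ⟨fun h0 ↦ hγ0 ((complexBetti_map_bijective_of_isIsogeny hg (2 * 3)).1 (by rw [h0, map_zero])), hγQ.map _, ?_⟩
  exact D.map_q_map_mem_weilClassesOf_of_intertwiner hqg hu hW

/-- **THE ISOGENY ORBIT LIES INSIDE (G3)'s DOMAIN**: at the identity chart of a datum with the anchor clauses for `h_Y(θ₀)` (polarisation class of
`Θ`, polarisation ∕ ample-line ∕ hyperbolicity clauses — all supplied at print's anchor by R2, `exists_secantQuotientDatum_compatibleClauses_of_pinned`),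
the pull-back of a non-zero rational class with `q^*γ` in the Weil plane along an ISOGENY `g` of `Y` intertwined through `q` with an endomorphism `u`
of `J × Ĵ` commuting with `φ_d` is PINNED-SERVED at `(Y, h_Y(θ₀))`. So (G3) OWES the directions `[u⁶]·[γ]` reached by the descended `K`-isogenies
`ḡ_u` (`u ∈ ℤ[φ_d]`, `φ_d(Ḡ) = Ḡ`) — and §2 pays exactly these, conditionally on pull-back stability of the door along `ḡ_u`.
[cite: Markman2025SecantWeil, Thm. 1.4.1 (item 4), §1.5 (p. 7) and §3.2 Cor. 3.2.3] [cite: vanGeemen1994HodgeAV, §3.6, 4.9 and Lemma 5.2] -/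
theorem map_mem_servedClassesPinned_of_intertwiner {θ₀ : complexBetti D.𝒥.J.X 2} (hθ₀ : D.𝒥.J.IsPolarizationClassOf D.Θ θ₀)
    (hpol : IsPolarizationClass 6 D.Y.X (D.hY θ₀)) (hamp : ∃ H : CartierDivisor D.Y.X.left, H.IsAmple ∧ D.Y.IsPolarizationClassOf H (D.hY θ₀))
    (hhyp : IsHyperbolicWeilType D.P D.ψ 3 (complexBetti.map D.q.hom.hom.hom 2 (D.hY θ₀)))
    {g : D.Y ⟶ D.Y} (hg : IsIsogeny g) {u : D.P ⟶ D.P} (hqg : D.q ≫ g = u ≫ D.q) (hu : D.ψ ≫ u = u ≫ D.ψ)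
    {γ : complexBetti D.Y.X (2 * 3)} (hγ0 : γ ≠ 0) (hγQ : IsRationalClass γ)
    (hW : complexBetti.map D.q.hom.hom.hom (2 * 3) γ ∈ weilClassesOf D.P D.ψ 3 D.d) :
    complexBetti.map g.hom.hom.hom (2 * 3) γ ∈ secantQuotientServedClassesPinned D.Y.X (D.hY θ₀) :=
  D.setOf_ne_zero_rational_weil_subset_servedClassesPinned hθ₀ hpol hamp hhyp
    (D.map_mem_setOf_ne_zero_rational_weil_of_intertwiner hg hqg hu ⟨hγ0, hγQ, hW⟩)

end SecantQuotientDatum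

/-- **MODULO PRINT'S PINNED CLAIM L1″(C, Adm): at print's level-`d` datum the served-and-carried class `γ₀` propagates along every `q`-intertwined
`K`-isogeny `g` of `Y` that scales `h_Y(θ₀)` and along which the door is pull-back stable — `g^*γ₀` is again PINNED-SERVED AND CARRIED.** This is the
exact content the isogeny mechanism contributes to stub 2a‴ at print's own anchor: the sixth-power coset of print's direction, CONDITIONALLY on the
displayed stability (for the twisted door: `Ext²(𝓑, 𝓑 ⊗ L) = 0` on `ker g^* ∖ 0`, OPEN; it FAILS for every `g` through `q`, companion memo §2).
Nothing outside that coset is touched. [cite: Markman2025SecantWeil, Thm. 1.4.1 (item 4), §1.5 (p. 7), §3.2 Cor. 3.2.3 and §9.3 Lemma 9.3.2, Lemma 9.3.11]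
[cite: Bloch1972Semiregularity, Remark (7.5)] [cite: BuchweitzFlenner2003, §5 Thm. 5.1] [cite: vanGeemen1994HodgeAV, §3.6 and 4.9] -/
theorem exists_datum_served_and_carried_along_intertwiner_of_pinned {C : ChernCharacterBetti} {Adm : PerfectAdmissibility}
    (hM : Markman2025_secantQuotient_twistedCarrier_onJacobian_pinned C Adm) {d : ℕ} (hd : Even d) (h4 : 4 ≤ d) :
    ∃ (D : SecantQuotientDatum) (θ₀ : complexBetti D.𝒥.J.X 2) (γ : complexBetti D.Y.X (2 * 3)),
      D.d = d ∧ D.𝒥.J.IsPolarizationClassOf D.Θ θ₀ ∧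
      γ ∈ secantQuotientServedClassesPinned D.Y.X (D.hY θ₀) ∧ γ ∈ carriedClasses (twistedReflexiveClass C Adm) 6 3 D.Y.X (D.hY θ₀) ∧
      ∀ (g : D.Y ⟶ D.Y) (u : D.P ⟶ D.P) (N : ℂ), IsIsogeny g → D.q ≫ g = u ≫ D.q → D.ψ ≫ u = u ≫ D.ψ →
        complexBetti.map g.hom.hom.hom 2 (D.hY θ₀) = N • D.hY θ₀ →
        (∀ (I : Finset ℕ) (κ : (q : ℕ) → complexBetti D.Y.X (2 * q)), twistedReflexiveClass C Adm 6 D.Y.X I κ →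
          twistedReflexiveClass C Adm 6 D.Y.X I (fun q ↦ complexBetti.map g.hom.hom.hom (2 * q) (κ q))) →
        complexBetti.map g.hom.hom.hom (2 * 3) γ ∈ secantQuotientServedClassesPinned D.Y.X (D.hY θ₀) ∧
        complexBetti.map g.hom.hom.hom (2 * 3) γ ∈ carriedClasses (twistedReflexiveClass C Adm) 6 3 D.Y.X (D.hY θ₀) := by
  obtain ⟨D, θ₀, γ, hDd, hθ₀, -, -, -, -, -, hpol, hamp, hhyp, -, hγQ, -, -, -, hγW, hpin, hcopy⟩ :=
    exists_secantQuotientDatum_compatibleClauses_of_pinned hM hd h4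
  have hγ0 : γ ≠ 0 := hpin.ne_zero
  have hc : γ ∈ carriedClasses (twistedReflexiveClass C Adm) 6 3 D.Y.X (D.hY θ₀) := by
    obtain ⟨I, κ, c, h3, hκ, hκ3, hκk⟩ := hcopy D.Y.X (Iso.refl D.Y.X)
    have hid2 : complexBetti.map (Iso.refl D.Y.X).hom 2 (D.hY θ₀) = D.hY θ₀ := by
      rw [Iso.refl_hom, complexBetti.map_id]; rfl
    have hid6 : complexBetti.map (Iso.refl D.Y.X).hom (2 * 3) γ = γ := by
      rw [Iso.refl_hom, complexBetti.map_id]; rfl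
    rw [hid2, hid6] at hκ3
    rw [hid2] at hκk
    exact ⟨I, κ, 1, c, h3, hκ, one_ne_zero, by rw [hκ3, one_smul], hκk⟩
  refine ⟨D, θ₀, γ, hDd, hθ₀, hpin, hc, fun g u N hg hqg hu hN h𝒪 ↦ ⟨?_, ?_⟩⟩
  · exact D.map_mem_servedClassesPinned_of_intertwiner hθ₀ hpol hamp hhyp hg hqg hu hγ0 hγQ hγW
  · exact map_mem_carriedClasses_of_pullbackStable g.hom.hom.hom hN h𝒪 hc


end Summit.HodgeConjecture.HodgeConjecture.Ring2.SemiregularRepresentatives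

end
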